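import Summits.QuantumFields.BalabanUV.Beta.GAN24.StripLegReadout
import Summits.QuantumFields.BalabanUV.Beta.GAN24.FibreStepResidues

/-!
# `BalabanUV.Beta.GAN24.StripLegUnits` — binder row G-an2-4 / (CONV-C), road P1-fibre, row **P1-L10** `FibreStrip` ((I3′)), cut «(M4) scaled alias-space
# Neumann, two anchors» (`HOME/b2b-balaban-gan24-formalise-leaf-16/L10-CUT-M4.md`), module **F8 part 3**: THE FOUR LEG BOUNDS COMBINED and the UNITS —
# (U2) `‖kFibΔ_j‖ ≤ Cst` on the strip AS A FUNCTION of F7's scaled a-priori bound, with an `N`-FREE `Cst` at `d = 3`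

NOT IN PRINT; OUR PROOF ATTEMPT (of the road; THIS file is [folklore] bookkeeping over `ℝ`/`ℂ`).  HONEST FRAMING (cell contract, verbatim): «discharging
`BetaPertH` makes Bałaban's UV stability UNCONDITIONAL — a real constructive-QFT result; it is NOT the continuum limit and NOT the Clay problem.»  HONEST
DEPENDENCY (verbatim): «continuum YM on T⁴ ⇐ BetaPertH ∧ nine spine estimates (0/9 proved); BetaPertH ⇐ (D1) ∧ (D4) ∧ CAP+tail; G-an2-4 gates asym, D1
and NE2/3/4.»  No cited fact, no wall binder, no `def … : Prop` fact (F7's a-priori bound and the cut's slot/row weight bounds are explicit `∀`-hypotheses);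
nothing of the K-slot of (CONV-C) is discharged here.  NOT summit progress.

## What is proved
* §1 (generic `d`, units `sf sm`, sides `0 < M ≤ N`, strip `|Im p_i| ≤ η ≤ 1/4`, `|Re p_i| ≤ π`): the four SQUARED leg bounds of `kFibW N M sf sm a x′ b y′ p`
  (ff / fm / mf / mm) as functions of the a-priori constant `A` and of the weight bounds `σ ≤ 1` (A-slots), `σ ≤ Sφ` (φ-slots), `|ρ| ≤ R0, RE` (EL rows on /
  off the zero alias), `|ρ| ≤ RQ` (Q rows) — parts 1–2 assembled (`StripLegVectors`, `StripLegReadout`).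
* §2 (THE STEP FAMILY AT `d = 3`: `N = Lc^(j+1)`, `M = Lc^j`, units `sfStep Lc j = Lc^j`, `smStep 3 Lc j = Lc^(4j)`; the cut's scaling `Sφ = r₀²/N³`,
  `R0 = N²/r₀²`, `RE = N²/4` (`r_m ≥ 2` off the zero alias), `RQ = N⁻⁵`; base points at box representatives `repZ zx`, `repZ zy`):
  **`norm_kFibΔ_sq_le_cstSq`**: `‖kFibΔ Lc (sfStep Lc) (smStep 3 Lc) j a (repZ zx) b (repZ zy) p‖² ≤ cstSq A η Lc r₀` with the `N`-FREE (i.e. `j`-free)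
  `cstSq A η Lc r₀ = A²·(E⁴·6¹⁰·5⁴·Lc¹²·(r₀⁻⁴ + 39) + E²·6⁵·5⁴·Lc⁻² + E²·6⁵·(1 + 39 r₀⁴)·Lc⁻² + r₀⁴·Lc⁻¹⁶)`, `E = exp(4ηLc)` (`39 = 624/16`); the un-squared form
  `norm_kFibΔ_le_sqrt_cstSq`, the all-base-points form (`FibreStepResidues.kFibΔ_eq_repZ`) and the monotone envelope `cstSq_mono` for `r₀ ∈ [ρ₁, ρ₂]`
  (F9 takes `r₀ = 1` inner, `r₀ = |Re p|₂ ∈ [ρ₀/2, 2π]` outer).  R3 of the cut is thereby discharged: only PRODUCTS of unit × weight × scale are `N`-free.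
Unit `b2b-balaban-gan24-p1` (row G-an2-4 owner, gen 2), 2026-08-20.
-/

noncomputable section

open Complex Finset Matrix
open scoped BigOperators Real
open Literature.Probability.LatticeModels (TorusSite Torus.proj)
open Literature.MathematicalPhysics.QuantumFieldTheory
open Literature.MathematicalPhysics.QuantumFieldTheory.LatticeForm (quo repZ)
open Literature.MathematicalPhysics.QuantumFieldTheory.Balaban1983to89
open Literature.MathematicalPhysics.QuantumFieldTheory.Balaban1983to89.Beta
open AffineAveraging (Site)
open BlochFibreMatrix (repZ_nonneg repZ_lt)
open BlochFibreUniqueness (quo_repZ)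
open FibreInverseDecay (cphase)
open OneStepResolventKernel (Fib)
open Summit.QuantumFields.BalabanUV.Beta.GAN24.CombesThomas (sfStep smStep)
open Summit.QuantumFields.BalabanUV.Beta.GAN24.CombesThomasFibreStep (kFibW kFib kFibΔ cphase_zero_left)
open Summit.QuantumFields.BalabanUV.Beta.GAN24.KFibClosedForm (legCoef)
open Summit.QuantumFields.BalabanUV.Beta.GAN24.KFibLegSource (legSrcVec)
open Summit.QuantumFields.BalabanUV.Beta.GAN24.ArrowOperator (AIdx arrowMat aliasArrow packSrc)
open Summit.QuantumFields.BalabanUV.Beta.GAN24.StripLegVectors (sum_norm_readW_sq_le_strip)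
open Summit.QuantumFields.BalabanUV.Beta.GAN24.StripLegReadout
  (norm_kFibW_inl_sq_le norm_kFibW_inr_sq_le sum_packSrc_inl_le sum_packSrc_inr_le)

namespace Summit.QuantumFields.BalabanUV.Beta.GAN24.StripLegUnits

/-! ## §1 The four squared leg bounds (generic `d`) -/

section Generic

variable {d N : ℕ} [NeZero N] {p : Fin (d + 1) → ℂ} {η : ℝ} {M : ℕ} {sf sm : ℝ}
variable {σ ρ : AIdx (d + 1) (TorusSite (d + 1) N) → ℝ} {A Sφ R0 RE RQ : ℝ}

/-- [folklore] The reading `ℓ²`-sum bound with the unit: `sf²·Σ_m ‖readW‖² ≤ sf²·e(x′)²·6^{D+1}·((N/M)²)^D·5^D`. -/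
theorem reading_le (him : ∀ i, |(p i).im| ≤ η) (hre : ∀ i, |(p i).re| ≤ π) (hη : 0 ≤ η) (hη4 : η ≤ 1 / 4) (hM : 0 < M) (hMN : M ≤ N)
    (κ : Fin (d + 1)) (x' : Site (d + 1)) :
    sf ^ 2 * ∑ m : TorusSite (d + 1) N, ‖AliasObjects.readW N M p m κ x'‖ ^ 2 ≤
      sf ^ 2 * (Real.exp (η * ∑ i, |(x' i : ℝ)|) ^ 2 * ((6 : ℝ) ^ (d + 1 + 1) * ((((N : ℝ) / M) ^ 2) ^ (d + 1) * (5 : ℝ) ^ (d + 1)))) :=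
  mul_le_mul_of_nonneg_left (sum_norm_readW_sq_le_strip (D := d + 1) him hre hη hη4 hM hMN κ x') (sq_nonneg _)

/-- [folklore] **ff**: `‖kFibW … (inl κ) x′ (inl l) y′ p‖² ≤ [sf² e(x′)² 6^{D+1} L^{2D} 5^D]·A²·[sf² N^{−2D} e(y′)² 6^{D+1} L^{2D} (R0² + RE²(5^D−1))]`. -/
theorem ff_sq_le (him : ∀ i, |(p i).im| ≤ η) (hre : ∀ i, |(p i).re| ≤ π) (hη : 0 ≤ η) (hη4 : η ≤ 1 / 4) (hM : 0 < M) (hMN : M ≤ N)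
    (hσ : ∀ i, 0 < σ i) (hσA : ∀ m κ, σ (Sum.inl (Sum.inl κ, m)) ≤ 1)
    (hAP : ∀ x, ∑ i, (‖x i‖ / σ i) ^ 2 ≤ A ^ 2 * ∑ i, (ρ i * ‖(arrowMat (aliasArrow N p) *ᵥ x) i‖) ^ 2)
    (κ : Fin (d + 1)) (x' : Site (d + 1)) (l : Fin (d + 1)) (y' : Site (d + 1))
    (hρ0 : |ρ (Sum.inl (Sum.inl l, 0))| ≤ R0) (hρE : ∀ m, m ≠ 0 → |ρ (Sum.inl (Sum.inl l, m))| ≤ RE) :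
    ‖kFibW N M sf sm (Sum.inl κ) x' (Sum.inl l) y' p‖ ^ 2 ≤
      (sf ^ 2 * (Real.exp (η * ∑ i, |(x' i : ℝ)|) ^ 2 * ((6 : ℝ) ^ (d + 1 + 1) * ((((N : ℝ) / M) ^ 2) ^ (d + 1) * (5 : ℝ) ^ (d + 1))))) *
        (A ^ 2 * (sf ^ 2 * ((((N : ℝ) ^ (d + 1)) ^ 2)⁻¹ *
          (Real.exp (η * ∑ i, |(y' i : ℝ)|) ^ 2 * ((6 : ℝ) ^ (d + 1 + 1) * (((N : ℝ) / M) ^ 2) ^ (d + 1)) * (R0 ^ 2 + RE ^ 2 * ((5 : ℝ) ^ (d + 1) - 1)))))) := by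
  refine (norm_kFibW_inl_sq_le hσ hσA hAP κ x' (Sum.inl l) y').trans ?_
  exact mul_le_mul (reading_le him hre hη hη4 hM hMN κ x')
    (mul_le_mul_of_nonneg_left (sum_packSrc_inl_le him hre hη hη4 hM hMN l y' hρ0 hρE) (sq_nonneg _))
    (mul_nonneg (sq_nonneg _) (Finset.sum_nonneg fun _ _ => sq_nonneg _)) (by positivity)

/-- [folklore] **fm**: `‖kFibW … (inl κ) x′ (inr l) y′ p‖² ≤ [sf² e(x′)² 6^{D+1} L^{2D} 5^D]·A²·(RQ·sm·‖cphase(−quo N (M•y′)) p‖)²`. -/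
theorem fm_sq_le (him : ∀ i, |(p i).im| ≤ η) (hre : ∀ i, |(p i).re| ≤ π) (hη : 0 ≤ η) (hη4 : η ≤ 1 / 4) (hM : 0 < M) (hMN : M ≤ N)
    (hσ : ∀ i, 0 < σ i) (hσA : ∀ m κ, σ (Sum.inl (Sum.inl κ, m)) ≤ 1) (hRQ : 0 ≤ RQ) (hsm : 0 ≤ sm)
    (hAP : ∀ x, ∑ i, (‖x i‖ / σ i) ^ 2 ≤ A ^ 2 * ∑ i, (ρ i * ‖(arrowMat (aliasArrow N p) *ᵥ x) i‖) ^ 2)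
    (κ : Fin (d + 1)) (x' : Site (d + 1)) (l : Fin (d + 1)) (y' : Site (d + 1)) (hρQ : |ρ (Sum.inr (Sum.inl l))| ≤ RQ) :
    ‖kFibW N M sf sm (Sum.inl κ) x' (Sum.inr l) y' p‖ ^ 2 ≤
      (sf ^ 2 * (Real.exp (η * ∑ i, |(x' i : ℝ)|) ^ 2 * ((6 : ℝ) ^ (d + 1 + 1) * ((((N : ℝ) / M) ^ 2) ^ (d + 1) * (5 : ℝ) ^ (d + 1))))) *
        (A ^ 2 * (RQ * sm * ‖cphase (-quo N ((M : ℤ) • y')) p‖) ^ 2) := by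
  refine (norm_kFibW_inl_sq_le hσ hσA hAP κ x' (Sum.inr l) y').trans ?_
  exact mul_le_mul (reading_le him hre hη hη4 hM hMN κ x')
    (mul_le_mul_of_nonneg_left (sum_packSrc_inr_le hRQ hsm l y' hρQ) (sq_nonneg _))
    (mul_nonneg (sq_nonneg _) (Finset.sum_nonneg fun _ _ => sq_nonneg _)) (by positivity)

/-- [folklore] **mf**: `‖kFibW … (inr κ) x′ (inl l) y′ p‖² ≤ (Sφ·sm·‖cphase(quo N (M•x′)) p‖)²·A²·[sf² N^{−2D} e(y′)² 6^{D+1} L^{2D} (R0² + RE²(5^D−1))]`. -/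
theorem mf_sq_le (him : ∀ i, |(p i).im| ≤ η) (hre : ∀ i, |(p i).re| ≤ π) (hη : 0 ≤ η) (hη4 : η ≤ 1 / 4) (hM : 0 < M) (hMN : M ≤ N)
    (hσ : ∀ i, 0 < σ i) (hσφ : ∀ κ, σ (Sum.inr (Sum.inl κ)) ≤ Sφ) (hsm : 0 ≤ sm)
    (hAP : ∀ x, ∑ i, (‖x i‖ / σ i) ^ 2 ≤ A ^ 2 * ∑ i, (ρ i * ‖(arrowMat (aliasArrow N p) *ᵥ x) i‖) ^ 2)
    (κ : Fin (d + 1)) (x' : Site (d + 1)) (l : Fin (d + 1)) (y' : Site (d + 1))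
    (hρ0 : |ρ (Sum.inl (Sum.inl l, 0))| ≤ R0) (hρE : ∀ m, m ≠ 0 → |ρ (Sum.inl (Sum.inl l, m))| ≤ RE) :
    ‖kFibW N M sf sm (Sum.inr κ) x' (Sum.inl l) y' p‖ ^ 2 ≤
      (Sφ * sm * ‖cphase (quo N ((M : ℤ) • x')) p‖) ^ 2 *
        (A ^ 2 * (sf ^ 2 * ((((N : ℝ) ^ (d + 1)) ^ 2)⁻¹ *
          (Real.exp (η * ∑ i, |(y' i : ℝ)|) ^ 2 * ((6 : ℝ) ^ (d + 1 + 1) * (((N : ℝ) / M) ^ 2) ^ (d + 1)) * (R0 ^ 2 + RE ^ 2 * ((5 : ℝ) ^ (d + 1) - 1)))))) := by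
  refine (norm_kFibW_inr_sq_le hσ hσφ hsm hAP κ x' (Sum.inl l) y').trans ?_
  exact mul_le_mul_of_nonneg_left (mul_le_mul_of_nonneg_left (sum_packSrc_inl_le him hre hη hη4 hM hMN l y' hρ0 hρE) (sq_nonneg _)) (sq_nonneg _)

/-- [folklore] **mm**: `‖kFibW … (inr κ) x′ (inr l) y′ p‖² ≤ (Sφ·sm·‖cphase(quo N (M•x′)) p‖)²·A²·(RQ·sm·‖cphase(−quo N (M•y′)) p‖)²`. -/
theorem mm_sq_le (hσ : ∀ i, 0 < σ i) (hσφ : ∀ κ, σ (Sum.inr (Sum.inl κ)) ≤ Sφ) (hRQ : 0 ≤ RQ) (hsm : 0 ≤ sm)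
    (hAP : ∀ x, ∑ i, (‖x i‖ / σ i) ^ 2 ≤ A ^ 2 * ∑ i, (ρ i * ‖(arrowMat (aliasArrow N p) *ᵥ x) i‖) ^ 2)
    (κ : Fin (d + 1)) (x' : Site (d + 1)) (l : Fin (d + 1)) (y' : Site (d + 1)) (hρQ : |ρ (Sum.inr (Sum.inl l))| ≤ RQ) :
    ‖kFibW N M sf sm (Sum.inr κ) x' (Sum.inr l) y' p‖ ^ 2 ≤
      (Sφ * sm * ‖cphase (quo N ((M : ℤ) • x')) p‖) ^ 2 * (A ^ 2 * (RQ * sm * ‖cphase (-quo N ((M : ℤ) • y')) p‖) ^ 2) := by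
  refine (norm_kFibW_inr_sq_le hσ hσφ hsm hAP κ x' (Sum.inr l) y').trans ?_
  exact mul_le_mul_of_nonneg_left (mul_le_mul_of_nonneg_left (sum_packSrc_inr_le hRQ hsm l y' hρQ) (sq_nonneg _)) (sq_nonneg _)

end Generic

/-! ## §2 The step family at `d = 3`: `N`-free constants -/

section StepThree

variable {Lc : ℕ} [NeZero Lc]

/-- [folklore] `0 < Lc` as a real number. -/
theorem lc_pos : (0 : ℝ) < Lc := by exact_mod_cast Nat.pos_of_ne_zero (NeZero.ne Lc)

/-- [folklore] `0 < Lc^j`. -/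
theorem pow_pos' (j : ℕ) : 0 < Lc ^ j := pow_pos (Nat.pos_of_ne_zero (NeZero.ne Lc)) j

/-- [folklore] `Lc^j ≤ Lc^(j+1)`. -/
theorem pow_le_pow_succ (j : ℕ) : Lc ^ j ≤ Lc ^ (j + 1) :=
  Nat.pow_le_pow_right (Nat.pos_of_ne_zero (NeZero.ne Lc)) (Nat.le_succ j)

/-- [folklore] **THE MULTIPLIER-LEG BLOCK INDEX OF A BOX REPRESENTATIVE VANISHES**: `quo (Lc^(j+1)) (Lc^j • repZ z) = 0` for `z ∈ (ℤ/Lc)^D`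
(`0 ≤ Lc^j·z_i < Lc^j·Lc`). -/
theorem quo_pow_smul_repZ {D : ℕ} (j : ℕ) (z : TorusSite D Lc) :
    quo (Lc ^ (j + 1)) ((((Lc ^ j : ℕ) : ℤ)) • repZ z) = 0 := by
  funext i
  simp only [quo, Pi.smul_apply, smul_eq_mul, Pi.zero_apply]
  have h0 : 0 ≤ ((Lc ^ j : ℕ) : ℤ) * repZ z i := mul_nonneg (by positivity) (repZ_nonneg z i)
  have h1 : ((Lc ^ j : ℕ) : ℤ) * repZ z i < ((Lc ^ (j + 1) : ℕ) : ℤ) := by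
    have hz := repZ_lt z i
    have hL : (0 : ℤ) < ((Lc ^ j : ℕ) : ℤ) := by exact_mod_cast pow_pos' (Lc := Lc) j
    calc ((Lc ^ j : ℕ) : ℤ) * repZ z i < ((Lc ^ j : ℕ) : ℤ) * (Lc : ℤ) := mul_lt_mul_of_pos_left hz hL
      _ = ((Lc ^ (j + 1) : ℕ) : ℤ) := by push_cast; ring
  exact Int.ediv_eq_zero_of_lt h0 h1

/-- [folklore] `kFibΔ` AT BOX REPRESENTATIVES IS `kFibW` (the offset phase is `cphase 0 = 1`, `quo Lc (repZ z) = 0`). -/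
theorem kFibΔ_repZ_eq_kFibW (sf sm : ℕ → ℝ) (j : ℕ) (a b : Fib 3) (zx zy : TorusSite 4 Lc) (p : Fin 4 → ℂ) :
    kFibΔ Lc sf sm j a (repZ zx) b (repZ zy) p = kFibW (Lc ^ (j + 1)) (Lc ^ j) (sf j) (sm j) a (repZ zx) b (repZ zy) p := by
  unfold kFibΔ kFib
  rw [quo_repZ, quo_repZ, sub_zero, cphase_zero_left, one_mul]

/-- [folklore] The leg-offset growth at a box representative: `exp(η·Σ_i |z_i|) ≤ exp(η·(4·Lc))` (`0 ≤ z_i < Lc`, `η ≥ 0`). -/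
theorem exp_offset_repZ_le {η : ℝ} (hη : 0 ≤ η) (z : TorusSite 4 Lc) :
    Real.exp (η * ∑ i, |((repZ z i : ℤ) : ℝ)|) ≤ Real.exp (η * (4 * Lc)) := by
  refine Real.exp_le_exp.2 (mul_le_mul_of_nonneg_left ?_ hη)
  calc ∑ i, |((repZ z i : ℤ) : ℝ)| ≤ ∑ _i : Fin 4, (Lc : ℝ) := by
        refine Finset.sum_le_sum fun i _ => ?_
        rw [abs_of_nonneg (by exact_mod_cast repZ_nonneg z i)]
        exact_mod_cast (repZ_lt z i).le
    _ = 4 * Lc := by simp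

/-- [folklore] THE `N`-FREE SQUARED CONSTANT of (U2) at `d = 3` in the cut's scaling with zero-alias radius `r₀` (`E = exp(4ηLc)`):
`cstSq A η Lc r₀ = A²·(E⁴·6¹⁰·5⁴·Lc¹²·(r₀⁻⁴ + 39) + E²·6⁵·5⁴·Lc⁻² + E²·6⁵·(1 + 39·r₀⁴)·Lc⁻² + r₀⁴·Lc⁻¹⁶)` (`39 = (5⁴ − 1)/2⁴`). -/
def cstSq (A η : ℝ) (Lc : ℕ) (r₀ : ℝ) : ℝ :=
  A ^ 2 * (Real.exp (η * (4 * Lc)) ^ 4 * ((6 : ℝ) ^ 10 * (5 : ℝ) ^ 4 * (Lc : ℝ) ^ 12) * (r₀⁻¹ ^ 4 + 39)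
    + Real.exp (η * (4 * Lc)) ^ 2 * ((6 : ℝ) ^ 5 * (5 : ℝ) ^ 4) * ((Lc : ℝ) ^ 2)⁻¹
    + Real.exp (η * (4 * Lc)) ^ 2 * (6 : ℝ) ^ 5 * (1 + 39 * r₀ ^ 4) * ((Lc : ℝ) ^ 2)⁻¹
    + r₀ ^ 4 * ((Lc : ℝ) ^ 16)⁻¹)

/-- [folklore] `0 ≤ cstSq`. -/
theorem cstSq_nonneg (A η : ℝ) (Lc : ℕ) (r₀ : ℝ) : 0 ≤ cstSq A η Lc r₀ := by
  unfold cstSq; positivity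

/-- [folklore] The ff term is below `cstSq`. -/
theorem term1_le_cstSq (A η : ℝ) (Lc : ℕ) (r₀ : ℝ) :
    A ^ 2 * (Real.exp (η * (4 * Lc)) ^ 4 * ((6 : ℝ) ^ 10 * (5 : ℝ) ^ 4 * (Lc : ℝ) ^ 12) * (r₀⁻¹ ^ 4 + 39)) ≤ cstSq A η Lc r₀ := by
  unfold cstSq
  refine mul_le_mul_of_nonneg_left ?_ (sq_nonneg _)
  have h2 : 0 ≤ Real.exp (η * (4 * Lc)) ^ 2 * ((6 : ℝ) ^ 5 * (5 : ℝ) ^ 4) * ((Lc : ℝ) ^ 2)⁻¹ := by positivity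
  have h3 : 0 ≤ Real.exp (η * (4 * Lc)) ^ 2 * (6 : ℝ) ^ 5 * (1 + 39 * r₀ ^ 4) * ((Lc : ℝ) ^ 2)⁻¹ := by positivity
  have h4 : 0 ≤ r₀ ^ 4 * ((Lc : ℝ) ^ 16)⁻¹ := by positivity
  linarith

/-- [folklore] The fm term is below `cstSq`. -/
theorem term2_le_cstSq (A η : ℝ) (Lc : ℕ) (r₀ : ℝ) :
    A ^ 2 * (Real.exp (η * (4 * Lc)) ^ 2 * ((6 : ℝ) ^ 5 * (5 : ℝ) ^ 4) * ((Lc : ℝ) ^ 2)⁻¹) ≤ cstSq A η Lc r₀ := by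
  unfold cstSq
  refine mul_le_mul_of_nonneg_left ?_ (sq_nonneg _)
  have h1 : 0 ≤ Real.exp (η * (4 * Lc)) ^ 4 * ((6 : ℝ) ^ 10 * (5 : ℝ) ^ 4 * (Lc : ℝ) ^ 12) * (r₀⁻¹ ^ 4 + 39) := by positivity
  have h3 : 0 ≤ Real.exp (η * (4 * Lc)) ^ 2 * (6 : ℝ) ^ 5 * (1 + 39 * r₀ ^ 4) * ((Lc : ℝ) ^ 2)⁻¹ := by positivity
  have h4 : 0 ≤ r₀ ^ 4 * ((Lc : ℝ) ^ 16)⁻¹ := by positivity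
  linarith

/-- [folklore] The mf term is below `cstSq`. -/
theorem term3_le_cstSq (A η : ℝ) (Lc : ℕ) (r₀ : ℝ) :
    A ^ 2 * (Real.exp (η * (4 * Lc)) ^ 2 * (6 : ℝ) ^ 5 * (1 + 39 * r₀ ^ 4) * ((Lc : ℝ) ^ 2)⁻¹) ≤ cstSq A η Lc r₀ := by
  unfold cstSq
  refine mul_le_mul_of_nonneg_left ?_ (sq_nonneg _)
  have h1 : 0 ≤ Real.exp (η * (4 * Lc)) ^ 4 * ((6 : ℝ) ^ 10 * (5 : ℝ) ^ 4 * (Lc : ℝ) ^ 12) * (r₀⁻¹ ^ 4 + 39) := by positivity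
  have h2 : 0 ≤ Real.exp (η * (4 * Lc)) ^ 2 * ((6 : ℝ) ^ 5 * (5 : ℝ) ^ 4) * ((Lc : ℝ) ^ 2)⁻¹ := by positivity
  have h4 : 0 ≤ r₀ ^ 4 * ((Lc : ℝ) ^ 16)⁻¹ := by positivity
  linarith

/-- [folklore] The mm term is below `cstSq`. -/
theorem term4_le_cstSq (A η : ℝ) (Lc : ℕ) (r₀ : ℝ) : A ^ 2 * (r₀ ^ 4 * ((Lc : ℝ) ^ 16)⁻¹) ≤ cstSq A η Lc r₀ := by
  unfold cstSq
  refine mul_le_mul_of_nonneg_left ?_ (sq_nonneg _)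
  have h1 : 0 ≤ Real.exp (η * (4 * Lc)) ^ 4 * ((6 : ℝ) ^ 10 * (5 : ℝ) ^ 4 * (Lc : ℝ) ^ 12) * (r₀⁻¹ ^ 4 + 39) := by positivity
  have h2 : 0 ≤ Real.exp (η * (4 * Lc)) ^ 2 * ((6 : ℝ) ^ 5 * (5 : ℝ) ^ 4) * ((Lc : ℝ) ^ 2)⁻¹ := by positivity
  have h3 : 0 ≤ Real.exp (η * (4 * Lc)) ^ 2 * (6 : ℝ) ^ 5 * (1 + 39 * r₀ ^ 4) * ((Lc : ℝ) ^ 2)⁻¹ := by positivity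
  linarith

/-- [folklore] **MONOTONE ENVELOPE**: for `0 < ρ₁ ≤ r₀ ≤ ρ₂`, `cstSq A η Lc r₀` is below the same expression with `r₀⁻⁴ ↦ ρ₁⁻⁴`, `r₀⁴ ↦ ρ₂⁴`
(F9: `r₀ = 1` inner; `r₀ = radO N q 0 ∈ [(2/π)·(ρ₀/2), 2π]` outer). -/
theorem cstSq_mono {A η ρ₁ ρ₂ r₀ : ℝ} {Lc : ℕ} (hρ₁ : 0 < ρ₁) (h1 : ρ₁ ≤ r₀) (h2 : r₀ ≤ ρ₂) :
    cstSq A η Lc r₀ ≤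
      A ^ 2 * (Real.exp (η * (4 * Lc)) ^ 4 * ((6 : ℝ) ^ 10 * (5 : ℝ) ^ 4 * (Lc : ℝ) ^ 12) * (ρ₁⁻¹ ^ 4 + 39)
        + Real.exp (η * (4 * Lc)) ^ 2 * ((6 : ℝ) ^ 5 * (5 : ℝ) ^ 4) * ((Lc : ℝ) ^ 2)⁻¹
        + Real.exp (η * (4 * Lc)) ^ 2 * (6 : ℝ) ^ 5 * (1 + 39 * ρ₂ ^ 4) * ((Lc : ℝ) ^ 2)⁻¹
        + ρ₂ ^ 4 * ((Lc : ℝ) ^ 16)⁻¹) := by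
  have hr : 0 < r₀ := lt_of_lt_of_le hρ₁ h1
  have hinv : r₀⁻¹ ≤ ρ₁⁻¹ := (inv_le_inv₀ hr hρ₁).2 h1
  have hinv0 : 0 ≤ r₀⁻¹ := inv_nonneg.2 hr.le
  unfold cstSq
  gcongr

/-! ### The four unit identities (`l = Lc`, `sf = l^j`, `sm = l^(4j)`, `N = l^(j+1)`) -/

/-- [folklore] ff: `sf²·sf²·N⁻⁸·(R0² + RE²·624) = (r₀⁻⁴ + 39)·l⁻⁴` with `R0 = N²/r₀²`, `RE = N²/4`. -/
theorem unit_ff {l r₀ : ℝ} (hl : l ≠ 0) (hr : r₀ ≠ 0) (j : ℕ) :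
    (l ^ j) ^ 2 * (l ^ j) ^ 2 * (((l ^ (j + 1)) ^ (3 + 1)) ^ 2)⁻¹ *
        (((l ^ (j + 1)) ^ 2 / r₀ ^ 2) ^ 2 + ((l ^ (j + 1)) ^ 2 / 4) ^ 2 * ((5 : ℝ) ^ (3 + 1) - 1)) = (r₀⁻¹ ^ 4 + 39) * (l ^ 4)⁻¹ := by
  field_simp
  ring

/-- [folklore] fm: `sf²·(RQ·sm)² = l⁻¹⁰` with `RQ = N⁻⁵`. -/
theorem unit_fm {l : ℝ} (hl : l ≠ 0) (j : ℕ) :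
    (l ^ j) ^ 2 * ((((l ^ (j + 1)) ^ 5)⁻¹ * l ^ (j * 4)) ^ 2) = (l ^ 10)⁻¹ := by
  field_simp
  ring

/-- [folklore] mf: `(Sφ·sm)²·sf²·N⁻⁸·(R0² + RE²·624) = (1 + 39·r₀⁴)·l⁻¹⁰` with `Sφ = r₀²/N³`. -/
theorem unit_mf {l r₀ : ℝ} (hl : l ≠ 0) (hr : r₀ ≠ 0) (j : ℕ) :
    (r₀ ^ 2 / (l ^ (j + 1)) ^ 3 * l ^ (j * 4)) ^ 2 * ((l ^ j) ^ 2 * (((l ^ (j + 1)) ^ (3 + 1)) ^ 2)⁻¹ *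
        (((l ^ (j + 1)) ^ 2 / r₀ ^ 2) ^ 2 + ((l ^ (j + 1)) ^ 2 / 4) ^ 2 * ((5 : ℝ) ^ (3 + 1) - 1))) = (1 + 39 * r₀ ^ 4) * (l ^ 10)⁻¹ := by
  field_simp
  ring

/-- [folklore] mm: `(Sφ·sm)²·(RQ·sm)² = r₀⁴·l⁻¹⁶`. -/
theorem unit_mm {l r₀ : ℝ} (hl : l ≠ 0) (j : ℕ) :
    (r₀ ^ 2 / (l ^ (j + 1)) ^ 3 * l ^ (j * 4)) ^ 2 * ((((l ^ (j + 1)) ^ 5)⁻¹ * l ^ (j * 4)) ^ 2) = r₀ ^ 4 * (l ^ 16)⁻¹ := by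
  field_simp
  ring

variable {η A r₀ : ℝ}

/-- [folklore] **(U2) AS A FUNCTION OF THE SCALED A-PRIORI BOUND, `d = 3`, SQUARED FORM.**  At step `j` (`N = Lc^(j+1)`, `M = Lc^j`), on the strip
`|Im p_i| ≤ η ≤ 1/4`, `|Re p_i| ≤ π`: if positive slot weights `σ` and row weights `ρ` satisfy the cut's bounds with zero-alias radius `r₀ > 0`
(A-slots `σ ≤ 1`, φ-slots `σ ≤ r₀²/N³`, EL rows `|ρ| ≤ N²/r₀²` on / `≤ N²/4` off the zero alias, Q rows `|ρ| ≤ N⁻⁵`) and the scaled a-priori bound with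
constant `A` holds for `arrowMat (aliasArrow N p)`, then for all legs and all box representatives
`‖kFibΔ Lc (sfStep Lc) (smStep 3 Lc) j a (repZ zx) b (repZ zy) p‖² ≤ cstSq A η Lc r₀`. -/
theorem norm_kFibΔ_sq_le_cstSq (hη : 0 ≤ η) (hη4 : η ≤ 1 / 4) (hr₀ : 0 < r₀) (j : ℕ) {p : Fin 4 → ℂ}
    (him : ∀ i, |(p i).im| ≤ η) (hre : ∀ i, |(p i).re| ≤ π)
    (σ ρ : AIdx 4 (TorusSite 4 (Lc ^ (j + 1))) → ℝ) (hσ : ∀ i, 0 < σ i)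
    (hσA : ∀ m κ, σ (Sum.inl (Sum.inl κ, m)) ≤ 1)
    (hσφ : ∀ κ, σ (Sum.inr (Sum.inl κ)) ≤ r₀ ^ 2 / ((Lc : ℝ) ^ (j + 1)) ^ 3)
    (hρ0 : ∀ κ, |ρ (Sum.inl (Sum.inl κ, 0))| ≤ ((Lc : ℝ) ^ (j + 1)) ^ 2 / r₀ ^ 2)
    (hρE : ∀ m, m ≠ 0 → ∀ κ, |ρ (Sum.inl (Sum.inl κ, m))| ≤ ((Lc : ℝ) ^ (j + 1)) ^ 2 / 4)
    (hρQ : ∀ κ, |ρ (Sum.inr (Sum.inl κ))| ≤ (((Lc : ℝ) ^ (j + 1)) ^ 5)⁻¹)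
    (hAP : ∀ x, ∑ i, (‖x i‖ / σ i) ^ 2 ≤ A ^ 2 * ∑ i, (ρ i * ‖(arrowMat (aliasArrow (Lc ^ (j + 1)) p) *ᵥ x) i‖) ^ 2)
    (a b : Fib 3) (zx zy : TorusSite 4 Lc) :
    ‖kFibΔ Lc (sfStep Lc) (smStep 3 Lc) j a (repZ zx) b (repZ zy) p‖ ^ 2 ≤ cstSq A η Lc r₀ := by
  have hl : (0 : ℝ) < Lc := lc_pos
  have hl0 : (Lc : ℝ) ≠ 0 := hl.ne'
  have hr0 : r₀ ≠ 0 := hr₀.ne'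
  have hM : 0 < Lc ^ j := pow_pos' j
  have hMN : Lc ^ j ≤ Lc ^ (j + 1) := pow_le_pow_succ j
  have hNR : ((Lc ^ (j + 1) : ℕ) : ℝ) = (Lc : ℝ) ^ (j + 1) := by push_cast; rfl
  have hratio : ((Lc ^ (j + 1) : ℕ) : ℝ) / ((Lc ^ j : ℕ) : ℝ) = Lc := by
    push_cast
    rw [pow_succ, mul_div_cancel_left₀ _ (pow_ne_zero _ hl0)]
  have hsf : sfStep Lc j = (Lc : ℝ) ^ j := rfl
  have hsm : smStep 3 Lc j = (Lc : ℝ) ^ (j * 4) := rfl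
  have hsm0 : 0 ≤ smStep 3 Lc j := by rw [hsm]; positivity
  have hφx : cphase (quo (Lc ^ (j + 1)) (((Lc ^ j : ℕ) : ℤ) • repZ zx)) p = 1 := by rw [quo_pow_smul_repZ, cphase_zero_left]
  have hφy : cphase (-quo (Lc ^ (j + 1)) (((Lc ^ j : ℕ) : ℤ) • repZ zy)) p = 1 := by rw [quo_pow_smul_repZ, neg_zero, cphase_zero_left]
  have hex := exp_offset_repZ_le (Lc := Lc) hη zx
  have hey := exp_offset_repZ_le (Lc := Lc) hη zy
  rw [kFibΔ_repZ_eq_kFibW]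
  rcases a with κ | κ <;> rcases b with l' | l'
  · -- ff
    have h := ff_sq_le (N := Lc ^ (j + 1)) (M := Lc ^ j) (sf := sfStep Lc j) (sm := smStep 3 Lc j) him hre hη hη4 hM hMN hσ hσA hAP
      κ (repZ zx) l' (repZ zy) (hρ0 l') (fun m hm => hρE m hm l')
    rw [hratio, hNR, hsf] at h
    set ex : ℝ := Real.exp (η * ∑ i, |((repZ zx i : ℤ) : ℝ)|) with hexd
    set ey : ℝ := Real.exp (η * ∑ i, |((repZ zy i : ℤ) : ℝ)|) with heyd
    set E : ℝ := Real.exp (η * (4 * Lc)) with hE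
    set l : ℝ := (Lc : ℝ) with hldef
    calc _ ≤ _ := h
      _ = A ^ 2 * ((l ^ j) ^ 2 * (l ^ j) ^ 2 * (((l ^ (j + 1)) ^ (3 + 1)) ^ 2)⁻¹ *
              (((l ^ (j + 1)) ^ 2 / r₀ ^ 2) ^ 2 + ((l ^ (j + 1)) ^ 2 / 4) ^ 2 * ((5 : ℝ) ^ (3 + 1) - 1))) *
            (ex ^ 2 * ey ^ 2 * ((6 : ℝ) ^ (3 + 1 + 1) * ((l ^ 2) ^ (3 + 1) * (5 : ℝ) ^ (3 + 1))) * ((6 : ℝ) ^ (3 + 1 + 1) * (l ^ 2) ^ (3 + 1))) := by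
          ring
      _ ≤ A ^ 2 * ((r₀⁻¹ ^ 4 + 39) * (l ^ 4)⁻¹) *
            (E ^ 2 * E ^ 2 * ((6 : ℝ) ^ (3 + 1 + 1) * ((l ^ 2) ^ (3 + 1) * (5 : ℝ) ^ (3 + 1))) * ((6 : ℝ) ^ (3 + 1 + 1) * (l ^ 2) ^ (3 + 1))) := by
          rw [unit_ff hl0 hr0 j]
          gcongr
      _ = A ^ 2 * (E ^ 4 * ((6 : ℝ) ^ 10 * (5 : ℝ) ^ 4 * l ^ 12) * (r₀⁻¹ ^ 4 + 39)) := by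
          field_simp
          ring
      _ ≤ cstSq A η Lc r₀ := term1_le_cstSq A η Lc r₀
  · -- fm
    have h := fm_sq_le (N := Lc ^ (j + 1)) (M := Lc ^ j) (sf := sfStep Lc j) (sm := smStep 3 Lc j) him hre hη hη4 hM hMN hσ hσA
      (by positivity) hsm0 hAP κ (repZ zx) l' (repZ zy) (hρQ l')
    rw [hratio, hsf, hsm, hφy, norm_one, mul_one] at h
    set ex : ℝ := Real.exp (η * ∑ i, |((repZ zx i : ℤ) : ℝ)|) with hexd
    set E : ℝ := Real.exp (η * (4 * Lc)) with hE
    set l : ℝ := (Lc : ℝ) with hldef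
    calc _ ≤ _ := h
      _ = A ^ 2 * ((l ^ j) ^ 2 * ((((l ^ (j + 1)) ^ 5)⁻¹ * l ^ (j * 4)) ^ 2)) *
            (ex ^ 2 * ((6 : ℝ) ^ (3 + 1 + 1) * ((l ^ 2) ^ (3 + 1) * (5 : ℝ) ^ (3 + 1)))) := by ring
      _ ≤ A ^ 2 * (l ^ 10)⁻¹ * (E ^ 2 * ((6 : ℝ) ^ (3 + 1 + 1) * ((l ^ 2) ^ (3 + 1) * (5 : ℝ) ^ (3 + 1)))) := by
          rw [unit_fm hl0 j]
          gcongr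
      _ = A ^ 2 * (E ^ 2 * ((6 : ℝ) ^ 5 * (5 : ℝ) ^ 4) * (l ^ 2)⁻¹) := by
          field_simp
          ring
      _ ≤ cstSq A η Lc r₀ := term2_le_cstSq A η Lc r₀
  · -- mf
    have h := mf_sq_le (N := Lc ^ (j + 1)) (M := Lc ^ j) (sf := sfStep Lc j) (sm := smStep 3 Lc j) him hre hη hη4 hM hMN hσ hσφ hsm0 hAP
      κ (repZ zx) l' (repZ zy) (hρ0 l') (fun m hm => hρE m hm l')
    rw [hratio, hNR, hsf, hsm, hφx, norm_one, mul_one] at h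
    set ey : ℝ := Real.exp (η * ∑ i, |((repZ zy i : ℤ) : ℝ)|) with heyd
    set E : ℝ := Real.exp (η * (4 * Lc)) with hE
    set l : ℝ := (Lc : ℝ) with hldef
    calc _ ≤ _ := h
      _ = A ^ 2 * ((r₀ ^ 2 / (l ^ (j + 1)) ^ 3 * l ^ (j * 4)) ^ 2 * ((l ^ j) ^ 2 * (((l ^ (j + 1)) ^ (3 + 1)) ^ 2)⁻¹ *
              (((l ^ (j + 1)) ^ 2 / r₀ ^ 2) ^ 2 + ((l ^ (j + 1)) ^ 2 / 4) ^ 2 * ((5 : ℝ) ^ (3 + 1) - 1)))) *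
            (ey ^ 2 * ((6 : ℝ) ^ (3 + 1 + 1) * (l ^ 2) ^ (3 + 1))) := by ring
      _ ≤ A ^ 2 * ((1 + 39 * r₀ ^ 4) * (l ^ 10)⁻¹) * (E ^ 2 * ((6 : ℝ) ^ (3 + 1 + 1) * (l ^ 2) ^ (3 + 1))) := by
          rw [unit_mf hl0 hr0 j]
          gcongr
      _ = A ^ 2 * (E ^ 2 * (6 : ℝ) ^ 5 * (1 + 39 * r₀ ^ 4) * (l ^ 2)⁻¹) := by
          field_simp
          ring
      _ ≤ cstSq A η Lc r₀ := term3_le_cstSq A η Lc r₀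
  · -- mm
    have h := mm_sq_le (N := Lc ^ (j + 1)) (M := Lc ^ j) (sf := sfStep Lc j) (sm := smStep 3 Lc j) (p := p) hσ hσφ (by positivity) hsm0 hAP
      κ (repZ zx) l' (repZ zy) (hρQ l')
    rw [hsm, hφx, hφy, norm_one, mul_one, mul_one] at h
    set l : ℝ := (Lc : ℝ) with hldef
    calc _ ≤ _ := h
      _ = A ^ 2 * ((r₀ ^ 2 / (l ^ (j + 1)) ^ 3 * l ^ (j * 4)) ^ 2 * ((((l ^ (j + 1)) ^ 5)⁻¹ * l ^ (j * 4)) ^ 2)) := by ring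
      _ = A ^ 2 * (r₀ ^ 4 * (l ^ 16)⁻¹) := by rw [unit_mm hl0 j]
      _ ≤ cstSq A η Lc r₀ := term4_le_cstSq A η Lc r₀

/-- [folklore] **(U2) AS A FUNCTION OF THE SCALED A-PRIORI BOUND, un-squared, all base points**:
`‖kFibΔ Lc (sfStep Lc) (smStep 3 Lc) j a x′ b y′ p‖ ≤ √(cstSq A η Lc r₀)` (residues by leaf-01's `FibreStepResidues.kFibΔ_eq_repZ`). -/
theorem norm_kFibΔ_le_sqrt_cstSq (hη : 0 ≤ η) (hη4 : η ≤ 1 / 4) (hr₀ : 0 < r₀) (j : ℕ) {p : Fin 4 → ℂ}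
    (him : ∀ i, |(p i).im| ≤ η) (hre : ∀ i, |(p i).re| ≤ π)
    (σ ρ : AIdx 4 (TorusSite 4 (Lc ^ (j + 1))) → ℝ) (hσ : ∀ i, 0 < σ i)
    (hσA : ∀ m κ, σ (Sum.inl (Sum.inl κ, m)) ≤ 1)
    (hσφ : ∀ κ, σ (Sum.inr (Sum.inl κ)) ≤ r₀ ^ 2 / ((Lc : ℝ) ^ (j + 1)) ^ 3)
    (hρ0 : ∀ κ, |ρ (Sum.inl (Sum.inl κ, 0))| ≤ ((Lc : ℝ) ^ (j + 1)) ^ 2 / r₀ ^ 2)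
    (hρE : ∀ m, m ≠ 0 → ∀ κ, |ρ (Sum.inl (Sum.inl κ, m))| ≤ ((Lc : ℝ) ^ (j + 1)) ^ 2 / 4)
    (hρQ : ∀ κ, |ρ (Sum.inr (Sum.inl κ))| ≤ (((Lc : ℝ) ^ (j + 1)) ^ 5)⁻¹)
    (hAP : ∀ x, ∑ i, (‖x i‖ / σ i) ^ 2 ≤ A ^ 2 * ∑ i, (ρ i * ‖(arrowMat (aliasArrow (Lc ^ (j + 1)) p) *ᵥ x) i‖) ^ 2)
    (a b : Fib 3) (x' y' : Fin 4 → ℤ) :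
    ‖kFibΔ Lc (sfStep Lc) (smStep 3 Lc) j a x' b y' p‖ ≤ Real.sqrt (cstSq A η Lc r₀) := by
  rw [FibreStepResidues.kFibΔ_eq_repZ]
  exact Real.le_sqrt_of_sq_le (norm_kFibΔ_sq_le_cstSq hη hη4 hr₀ j him hre σ ρ hσ hσA hσφ hρ0 hρE hρQ hAP a b _ _)

end StepThree

end Summit.QuantumFields.BalabanUV.Beta.GAN24.StripLegUnits

end
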